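import Mathlib.Analysis.Complex.CauchyIntegral
import Mathlib.Analysis.Complex.Harmonic.Analytic
import Literature.Probability.LatticeModels.LatticeLaplacian
import Literature.Probability.LatticeModels.DomainDiscretisation
import HarnessLib

/-!
# Consistency of the five-point Laplacian: `Δ_δ F = O(δ⁴)` for harmonic `F`

Topic `Literature/Probability/LatticeModels` (discrete potential theory on `δℤ²`; the
"consistency" half of the consistency-and-stability argument on the discharge path of
`Kenyon2000_flatEdgePoissonKernelLimit`, cf. Kenyon 2000, Lemma 17: "since `g` is smooth … its
discrete Laplacian is within `O(ε⁴ sup |g⁽⁴⁾|)` of its continuous Laplacian").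

Instead of a real Taylor expansion we use the power series of a holomorphic `H` with `F = re H`:
if `H(z + y) = ∑ cₙ yⁿ` on `|y| < R` then
`H(z+δ) + H(z-δ) + H(z+iδ) + H(z-iδ) - 4 H(z) = ∑_{n ≥ 4} cₙ δⁿ (1 + (-1)ⁿ + iⁿ + (-i)ⁿ)`
(the bracket vanishes for `n = 1, 2, 3`), and the Cauchy estimates `|cₙ| ≤ A R⁻ⁿ` give the bound
`8 A (δ/R)⁴` for `δ ≤ R/2`. PROVED here:

* `norm_fivePoint_sub_le` — the estimate above for `H` holomorphic on `closedBall z R`,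
  `‖H‖ ≤ A` on the circle;
* `meshPoint_add_cornerUnit_zero` … `_three` — the four mesh neighbours of `meshPoint δ v`;
* `abs_latticeLaplacian_re_meshPoint_le` — the same bound for the lattice Laplacian of
  `v ↦ F (meshPoint δ v)` when `F = re H` on the ball;
* **`exists_abs_latticeLaplacian_meshPoint_le_of_harmonicOnNhd`** — for `F` harmonic on an open
  set `U ⊆ ℂ` and `K ⊆ U` compact there are `C, δ₀ > 0` with
  `|Δ (F ∘ meshPoint δ) (v)| ≤ C δ⁴` whenever `0 < δ ≤ δ₀` and `meshPoint δ v ∈ K`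
  (Mathlib's `HarmonicOnNhd.exists_analyticOnNhd_ball_re_eq` writes `F = re H` locally).

Everything is proved, [folklore]; no named fact.

## References

* R. Kenyon, *Conformal invariance of domino tiling*, Ann. Probab. 28 (2000), proof of Lemma 17
  [Kenyon2000].
* R. Courant, K. Friedrichs, H. Lewy, Math. Ann. 100 (1928), §2 [folklore].
-/

noncomputable section

namespace Literature.Probability.LatticeModels

open Complex Metric Filter Finset
open scoped Real NNReal Topology

/-- **Five-point consistency for a holomorphic function.** If `H` is holomorphic on
`closedBall z R` and `‖H‖ ≤ A` on the circle `sphere z R`, then for `0 ≤ δ ≤ R/2`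
`‖H(z+δ) + H(z-δ) + H(z+iδ) + H(z-iδ) - 4H(z)‖ ≤ 8 A (δ/R)⁴`
(power series at `z` + Cauchy estimates; the terms of order `1, 2, 3` cancel). [folklore] -/
theorem norm_fivePoint_sub_le {H : ℂ → ℂ} {z : ℂ} {R A δ : ℝ} (hR : 0 < R)
    (hH : DifferentiableOn ℂ H (closedBall z R)) (hA : ∀ w ∈ sphere z R, ‖H w‖ ≤ A)
    (hδ0 : 0 ≤ δ) (hδ : δ ≤ R / 2) :
    ‖H (z + δ) + H (z - δ) + H (z + δ * I) + H (z - δ * I) - 4 * H z‖ ≤ 8 * A * (δ / R) ^ 4 := by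
  lift R to ℝ≥0 using hR.le
  have hR' : (0 : ℝ≥0) < R := by exact_mod_cast hR
  set p : FormalMultilinearSeries ℂ ℂ ℂ := cauchyPowerSeries H z R with hp_def
  have hp : HasFPowerSeriesOnBall H p z R := hH.hasFPowerSeriesOnBall hR'
  -- `A` is nonnegative (the circle is nonempty)
  have hzR : z + (R : ℝ) ∈ sphere z (R : ℝ) := by
    rw [mem_sphere, dist_eq, add_sub_cancel_left, norm_real, Real.norm_eq_abs, abs_of_pos hR]
  have hA0 : 0 ≤ A := (norm_nonneg _).trans (hA _ hzR)
  -- Cauchy estimates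
  have hcoef : ∀ n, ‖p.coeff n‖ ≤ A * (R : ℝ)⁻¹ ^ n := by
    intro n
    rw [← FormalMultilinearSeries.norm_apply_eq_norm_coef]
    refine (norm_cauchyPowerSeries_le H z R n).trans ?_
    rw [abs_of_pos hR]
    have hint : ∫ θ in (0 : ℝ)..2 * π, ‖H (circleMap z R θ)‖ ≤ A * (2 * π) := by
      have h1 : ‖∫ θ in (0 : ℝ)..2 * π, ‖H (circleMap z R θ)‖‖ ≤ A * |2 * π - 0| := by
        refine intervalIntegral.norm_integral_le_of_norm_le_const ?_
        intro θ _
        rw [norm_norm]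
        exact hA _ (circleMap_mem_sphere z R.2 θ)
      rw [sub_zero, abs_of_pos Real.two_pi_pos, Real.norm_eq_abs] at h1
      exact (le_abs_self _).trans h1
    calc (2 * π)⁻¹ * (∫ θ in (0 : ℝ)..2 * π, ‖H (circleMap z R θ)‖) * (R : ℝ)⁻¹ ^ n
        ≤ (2 * π)⁻¹ * (A * (2 * π)) * (R : ℝ)⁻¹ ^ n := by gcongr
      _ = A * (R : ℝ)⁻¹ ^ n := by field_simp
  -- the expansions at the four neighbours
  have hsum : ∀ y : ℂ, ‖y‖ < R → HasSum (fun n => y ^ n * p.coeff n) (H (z + y)) := by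
    intro y hy
    have hy' : y ∈ Metric.eball (0 : ℂ) R := by
      rw [Metric.eball_coe]; exact mem_ball_zero_iff.2 hy
    simpa only [FormalMultilinearSeries.apply_eq_pow_smul_coeff, smul_eq_mul] using hp.hasSum hy'
  have hδR : δ < R := by linarith
  have hn1 : ‖(δ : ℂ)‖ < R := by rwa [norm_real, Real.norm_eq_abs, abs_of_nonneg hδ0]
  have hn2 : ‖(-(δ : ℂ))‖ < R := by rwa [norm_neg]
  have hn3 : ‖(δ : ℂ) * I‖ < R := by rwa [norm_mul, norm_I, mul_one]
  have hn4 : ‖(-((δ : ℂ) * I))‖ < R := by rwa [norm_neg]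
  have hS := (((hsum _ hn1).add (hsum _ hn2)).add (hsum _ hn3)).add (hsum _ hn4)
  -- the combined series
  set q : ℕ → ℂ := fun n =>
    ((δ : ℂ) ^ n + (-(δ : ℂ)) ^ n + ((δ : ℂ) * I) ^ n + (-((δ : ℂ) * I)) ^ n) * p.coeff n with hq
  have hS' : HasSum q (H (z + δ) + H (z - δ) + H (z + δ * I) + H (z - δ * I)) := by
    convert hS using 1
    · funext n; simp only [hq]; ring
    · simp only [sub_eq_add_neg]
  -- split off the first four terms: `q 0 = 4 H z`, `q 1 = q 2 = q 3 = 0`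
  have htail := (hasSum_nat_add_iff' 4).2 hS'
  have hc0 : p.coeff 0 = H z := hp.coeff_zero _
  have h4 : ∑ i ∈ range 4, q i = 4 * H z := by
    simp only [hq, Finset.sum_range_succ, Finset.sum_range_zero, hc0]
    linear_combination (2 * (δ : ℂ) ^ 2 * p.coeff 2) * I_sq
  rw [h4] at htail
  -- the tail is dominated by a geometric series
  have hr0 : 0 ≤ δ / R := div_nonneg hδ0 hR.le
  have hr1 : δ / R ≤ 1 / 2 := by rw [div_le_iff₀ hR]; linarith
  have hqn : ∀ n, ‖q (n + 4)‖ ≤ 4 * A * (δ / R) ^ 4 * (δ / R) ^ n := by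
    intro n
    have e : ∀ y : ℂ, ‖y‖ = δ → ‖y ^ (n + 4)‖ = δ ^ (n + 4) := fun y hy => by rw [norm_pow, hy]
    have hy1 : ‖(δ : ℂ)‖ = δ := by rw [norm_real, Real.norm_eq_abs, abs_of_nonneg hδ0]
    have hy2 : ‖(-(δ : ℂ))‖ = δ := by rw [norm_neg, hy1]
    have hy3 : ‖(δ : ℂ) * I‖ = δ := by rw [norm_mul, norm_I, mul_one, hy1]
    have hy4 : ‖(-((δ : ℂ) * I))‖ = δ := by rw [norm_neg, hy3]
    have hpow : ‖(δ : ℂ) ^ (n + 4) + (-(δ : ℂ)) ^ (n + 4) + ((δ : ℂ) * I) ^ (n + 4) +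
        (-((δ : ℂ) * I)) ^ (n + 4)‖ ≤ 4 * δ ^ (n + 4) := by
      refine (norm_add_le _ _).trans ?_
      refine (add_le_add ((norm_add_le _ _).trans (add_le_add (norm_add_le _ _) le_rfl))
        le_rfl).trans ?_
      rw [e _ hy1, e _ hy2, e _ hy3, e _ hy4]
      linarith
    have hRn : (0 : ℝ) ≤ (R : ℝ)⁻¹ ^ (n + 4) := by positivity
    calc ‖q (n + 4)‖ = ‖(δ : ℂ) ^ (n + 4) + (-(δ : ℂ)) ^ (n + 4) + ((δ : ℂ) * I) ^ (n + 4) +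
          (-((δ : ℂ) * I)) ^ (n + 4)‖ * ‖p.coeff (n + 4)‖ := by
          simp only [hq]; rw [norm_mul]
      _ ≤ 4 * δ ^ (n + 4) * (A * (R : ℝ)⁻¹ ^ (n + 4)) :=
          mul_le_mul hpow (hcoef _) (norm_nonneg _) (by positivity)
      _ = 4 * A * (δ / R) ^ 4 * (δ / R) ^ n := by rw [div_eq_mul_inv]; ring
  have hgeom : HasSum (fun n => 4 * A * (δ / R) ^ 4 * (δ / R) ^ n)
      (4 * A * (δ / R) ^ 4 * (1 - δ / R)⁻¹) :=
    (hasSum_geometric_of_lt_one hr0 (by linarith)).mul_left _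
  have hbound := htail.norm_le_of_bounded hgeom hqn
  have hinv : (1 - δ / R)⁻¹ ≤ 2 := by
    rw [inv_le_comm₀ (by linarith) (by norm_num)]; linarith
  have hnn : 0 ≤ 4 * A * (δ / R) ^ 4 := mul_nonneg (mul_nonneg (by norm_num) hA0) (pow_nonneg hr0 4)
  calc ‖H (z + δ) + H (z - δ) + H (z + δ * I) + H (z - δ * I) - 4 * H z‖
      ≤ 4 * A * (δ / R) ^ 4 * (1 - δ / R)⁻¹ := hbound
    _ ≤ 4 * A * (δ / R) ^ 4 * 2 := mul_le_mul_of_nonneg_left hinv hnn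
    _ = 8 * A * (δ / R) ^ 4 := by ring

/-- The east mesh neighbour: `meshPoint δ (v + e₀) = meshPoint δ v + δ`. [folklore] -/
theorem meshPoint_add_cornerUnit_zero (δ : ℝ) (v : Site 2) :
    meshPoint δ (v + cornerUnit 0) = meshPoint δ v + δ := by
  have h0 : (v + cornerUnit 0) 0 = v 0 + 1 := by simp [cornerUnit]
  have h1 : (v + cornerUnit 0) 1 = v 1 := by simp [cornerUnit]
  apply Complex.ext
  · rw [meshPoint_re, h0, add_re, meshPoint_re, ofReal_re]; push_cast; ring
  · rw [meshPoint_im, h1, add_im, meshPoint_im, ofReal_im, add_zero]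

/-- The north mesh neighbour: `meshPoint δ (v + e₁) = meshPoint δ v + δ i`. [folklore] -/
theorem meshPoint_add_cornerUnit_one (δ : ℝ) (v : Site 2) :
    meshPoint δ (v + cornerUnit 1) = meshPoint δ v + δ * I := by
  have h0 : (v + cornerUnit 1) 0 = v 0 := by simp [cornerUnit]
  have h1 : (v + cornerUnit 1) 1 = v 1 + 1 := by simp [cornerUnit]
  apply Complex.ext
  · rw [meshPoint_re, h0, add_re, meshPoint_re, mul_re, ofReal_re, ofReal_im, I_re, I_im]; ring
  · rw [meshPoint_im, h1, add_im, meshPoint_im, mul_im, ofReal_re, ofReal_im, I_re, I_im]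
    push_cast; ring

/-- The west mesh neighbour: `meshPoint δ (v - e₀) = meshPoint δ v - δ`. [folklore] -/
theorem meshPoint_add_cornerUnit_two (δ : ℝ) (v : Site 2) :
    meshPoint δ (v + cornerUnit 2) = meshPoint δ v - δ := by
  have h0 : (v + cornerUnit 2) 0 = v 0 - 1 := by simp [cornerUnit, sub_eq_add_neg]
  have h1 : (v + cornerUnit 2) 1 = v 1 := by simp [cornerUnit]
  apply Complex.ext
  · rw [meshPoint_re, h0, sub_re, meshPoint_re, ofReal_re]; push_cast; ring
  · rw [meshPoint_im, h1, sub_im, meshPoint_im, ofReal_im, sub_zero]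

/-- The south mesh neighbour: `meshPoint δ (v - e₁) = meshPoint δ v - δ i`. [folklore] -/
theorem meshPoint_add_cornerUnit_three (δ : ℝ) (v : Site 2) :
    meshPoint δ (v + cornerUnit 3) = meshPoint δ v - δ * I := by
  have h0 : (v + cornerUnit 3) 0 = v 0 := by simp [cornerUnit]
  have h1 : (v + cornerUnit 3) 1 = v 1 - 1 := by simp [cornerUnit, sub_eq_add_neg]
  apply Complex.ext
  · rw [meshPoint_re, h0, sub_re, meshPoint_re, mul_re, ofReal_re, ofReal_im, I_re, I_im]; ring
  · rw [meshPoint_im, h1, sub_im, meshPoint_im, mul_im, ofReal_re, ofReal_im, I_re, I_im]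
    push_cast; ring

/-- **Five-point consistency on the mesh.** If `F = re H` on `closedBall (meshPoint δ v) R` with
`H` holomorphic there and `‖H‖ ≤ A` on the circle, then for `0 < δ ≤ R/2` the lattice Laplacian of
`u ↦ F (meshPoint δ u)` at `v` is at most `8 A (δ/R)⁴` in absolute value. [folklore] -/
theorem abs_latticeLaplacian_re_meshPoint_le {H : ℂ → ℂ} {F : ℂ → ℝ} {δ R A : ℝ} {v : Site 2}
    (hR : 0 < R) (hH : DifferentiableOn ℂ H (closedBall (meshPoint δ v) R))
    (hA : ∀ w ∈ sphere (meshPoint δ v) R, ‖H w‖ ≤ A)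
    (hF : ∀ w ∈ closedBall (meshPoint δ v) R, F w = (H w).re)
    (hδ0 : 0 < δ) (hδ : δ ≤ R / 2) :
    |latticeLaplacian (fun u => F (meshPoint δ u)) v| ≤ 8 * A * (δ / R) ^ 4 := by
  have key := norm_fivePoint_sub_le hR hH hA hδ0.le hδ
  set m := meshPoint δ v with hm
  have hδR : δ ≤ R := by linarith
  have hnδ : ‖(δ : ℂ)‖ = δ := by rw [norm_real, Real.norm_eq_abs, abs_of_pos hδ0]
  have hnδI : ‖(δ : ℂ) * I‖ = δ := by rw [norm_mul, norm_I, mul_one, hnδ]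
  have m0 : m + δ ∈ closedBall m R := by
    rw [mem_closedBall, dist_eq, add_sub_cancel_left, hnδ]; exact hδR
  have m1 : m + δ * I ∈ closedBall m R := by
    rw [mem_closedBall, dist_eq, add_sub_cancel_left, hnδI]; exact hδR
  have m2 : m - δ ∈ closedBall m R := by
    rw [mem_closedBall, dist_eq, sub_sub_cancel_left, norm_neg, hnδ]; exact hδR
  have m3 : m - δ * I ∈ closedBall m R := by
    rw [mem_closedBall, dist_eq, sub_sub_cancel_left, norm_neg, hnδI]; exact hδR
  rw [latticeLaplacian_eq, Fin.sum_univ_four, meshPoint_add_cornerUnit_zero,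
    meshPoint_add_cornerUnit_one, meshPoint_add_cornerUnit_two, meshPoint_add_cornerUnit_three,
    ← hm, hF _ m0, hF _ m1, hF _ m2, hF _ m3, hF _ (mem_closedBall_self hR.le)]
  have : (H (m + δ)).re + (H (m + δ * I)).re + (H (m - δ)).re + (H (m - δ * I)).re - 4 * (H m).re
      = (H (m + δ) + H (m - δ) + H (m + δ * I) + H (m - δ * I) - 4 * H m).re := by
    simp only [add_re, sub_re, mul_re, re_ofNat, im_ofNat]; ring
  rw [this]
  exact (abs_re_le_norm _).trans key

/-- **Consistency of the five-point Laplacian for harmonic functions, uniformly on compacts.**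
If `F : ℂ → ℝ` is harmonic on an open set `U` and `K ⊆ U` is compact, there are `C ≥ 0` and
`δ₀ > 0` such that `|Δ (u ↦ F (meshPoint δ u)) (v)| ≤ C δ⁴` whenever `0 < δ ≤ δ₀` and
`meshPoint δ v ∈ K`. (Locally `F = re H` with `H` holomorphic, by Mathlib's
`HarmonicOnNhd.exists_analyticOnNhd_ball_re_eq`; then `abs_latticeLaplacian_re_meshPoint_le` and a
finite subcover.) Kenyon 2000, proof of Lemma 17 ("its discrete Laplacian is within
`O(ε⁴ sup|g⁽⁴⁾|)` of its continuous Laplacian"). [cite: Kenyon2000, proof of Lemma 17] -/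
theorem exists_abs_latticeLaplacian_meshPoint_le_of_harmonicOnNhd {F : ℂ → ℝ} {U K : Set ℂ}
    (hU : IsOpen U) (hF : InnerProductSpace.HarmonicOnNhd F U) (hK : IsCompact K) (hKU : K ⊆ U) :
    ∃ C δ₀ : ℝ, 0 ≤ C ∧ 0 < δ₀ ∧ ∀ δ : ℝ, 0 < δ → δ ≤ δ₀ → ∀ v : Site 2, meshPoint δ v ∈ K →
      |latticeLaplacian (fun u => F (meshPoint δ u)) v| ≤ C * δ ^ 4 := by
  -- local statement at every point of `U`
  have hloc : ∀ z ∈ U, ∃ ρ > 0, ∃ A ≥ 0, ∀ δ : ℝ, 0 < δ → δ ≤ ρ / 8 → ∀ v : Site 2,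
      meshPoint δ v ∈ ball z (ρ / 4) →
      |latticeLaplacian (fun u => F (meshPoint δ u)) v| ≤ 2048 * A / ρ ^ 4 * δ ^ 4 := by
    intro z hz
    obtain ⟨ρ, hρ, hρU⟩ := Metric.isOpen_iff.1 hU z hz
    obtain ⟨H, hHan, hHre⟩ := (hF.mono hρU).exists_analyticOnNhd_ball_re_eq
    have hHc : ContinuousOn H (closedBall z (ρ / 2)) :=
      hHan.continuousOn.mono (closedBall_subset_ball (by linarith))
    obtain ⟨A, hA⟩ := (isCompact_closedBall z (ρ / 2)).exists_bound_of_continuousOn hHc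
    have hA0 : 0 ≤ A := (norm_nonneg _).trans (hA z (mem_closedBall_self (by linarith)))
    refine ⟨ρ, hρ, A, hA0, fun δ hδ0 hδ v hv => ?_⟩
    have hsub : closedBall (meshPoint δ v) (ρ / 4) ⊆ closedBall z (ρ / 2) := by
      intro w hw
      rw [mem_closedBall] at hw ⊢
      have := mem_ball.1 hv
      linarith [dist_triangle w (meshPoint δ v) z]
    have hsub' : closedBall (meshPoint δ v) (ρ / 4) ⊆ ball z ρ :=
      hsub.trans (closedBall_subset_ball (by linarith))
    have key := abs_latticeLaplacian_re_meshPoint_le (R := ρ / 4) (A := A) (F := F) (by linarith)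
      (hHan.differentiableOn.mono hsub')
      (fun w hw => hA w (hsub (sphere_subset_closedBall hw)))
      (fun w hw => (hHre (hsub' hw)).symm) hδ0 (by linarith)
    refine key.trans (le_of_eq ?_)
    field_simp
    ring
  -- junk values outside `U`, then choice functions
  have hloc' : ∀ z : ℂ, ∃ ρ > 0, ∃ A ≥ 0, z ∈ U → ∀ δ : ℝ, 0 < δ → δ ≤ ρ / 8 → ∀ v : Site 2,
      meshPoint δ v ∈ ball z (ρ / 4) →
      |latticeLaplacian (fun u => F (meshPoint δ u)) v| ≤ 2048 * A / ρ ^ 4 * δ ^ 4 := by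
    intro z
    by_cases hz : z ∈ U
    · obtain ⟨ρ, hρ, A, hA, h⟩ := hloc z hz
      exact ⟨ρ, hρ, A, hA, fun _ => h⟩
    · exact ⟨1, one_pos, 0, le_rfl, fun h => absurd h hz⟩
  choose ρ hρ A hA0 hP using hloc'
  -- finite subcover of `K`
  obtain ⟨t, htK, hcover⟩ := hK.elim_nhds_subcover (fun z => ball z (ρ z / 4))
    (fun z _ => ball_mem_nhds z (by linarith [hρ z]))
  set s : Finset ℝ := insert 1 (t.image fun z => ρ z / 8) with hs
  have hsne : s.Nonempty := Finset.insert_nonempty _ _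
  refine ⟨∑ z ∈ t, 2048 * A z / ρ z ^ 4, s.min' hsne, ?_, ?_, ?_⟩
  · exact Finset.sum_nonneg fun z _ => by have := hρ z; have := hA0 z; positivity
  · refine (Finset.lt_min'_iff s hsne).2 fun y hy => ?_
    rcases Finset.mem_insert.1 hy with rfl | hy
    · exact one_pos
    · obtain ⟨z, -, rfl⟩ := Finset.mem_image.1 hy
      linarith [hρ z]
  · intro δ hδ0 hδ v hvK
    obtain ⟨z, hz, hvz⟩ := Set.mem_iUnion₂.1 (hcover hvK)
    have hzt : z ∈ t := hz
    have hδz : δ ≤ ρ z / 8 :=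
      hδ.trans (Finset.min'_le s _ (Finset.mem_insert_of_mem (Finset.mem_image_of_mem _ hzt)))
    have key := hP z (hKU (htK z hzt)) δ hδ0 hδz v hvz
    refine key.trans ?_
    have hle : 2048 * A z / ρ z ^ 4 ≤ ∑ z ∈ t, 2048 * A z / ρ z ^ 4 :=
      Finset.single_le_sum (f := fun z => 2048 * A z / ρ z ^ 4)
        (fun y _ => by have := hρ y; have := hA0 y; positivity) hzt
    exact mul_le_mul_of_nonneg_right hle (by positivity)

end Literature.Probability.LatticeModels
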